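import Summits.NavierStokesRegularity.FunctionalMining.TopEigHeatRate
import Summits.NavierStokesRegularity.FunctionalMining.SpectralMixtureCandidates
import HarnessLib

/-!
# FunctionalMining/NoGo — the symmetrised heat node of door D-K6 (c): the heat price of `Φ_q + Ψ_q`
# is the SUM of the one-sided heat prices; kernel window `C_λ(q) ≤ C_λ^sym(q) ≤ 4π²q`; a kill of
# the symmetrised L-λ lemma kills the one-sided one (K6, nogo seat gen 36)

NS FUNCTIONAL MINING — search for candidate a priori estimates; no regularity claim.

[ours: cell `pub-nsfunc`, nogo seat gen 36 (`planner-pub-nsfunc-nogo-g36-0`), 2026-08-23. STAGED as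
`pub-nsfunc-nogo/NoGo/TopBotEigHeatWindow.STAGING.lean`; to be filed by the prove seat as
`Summits/NavierStokesRegularity/FunctionalMining/NoGo/TopBotEigHeatWindow.lean`. Imports ONLY the
tree: `TopEigHeatRate` (dict seat: `heatRate`, `heatRateSet`, `topEigHeatRate q` = `C_λ(q)` and its
window `[0, 4π²q]`) and through it `TopEigHeatConvex` (`heatDissipation_eq_neg_rightDeriv`, the
heat-line convexity of the two cores, the Laplace-eigenfield calibration), `TopEigHeatCoerciveRate`
(the single-shell crossed shear `csField E₀ E₀`), `TopEigHeatCoerciveSymm` (`negBotEigHeatCoercive_iff`),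
`TopEigHeatStable` (`topEigHeatCoercive_zero`); and `SpectralMixtureCandidates` (dict seat:
`topBotEigMoment`, `TopBotEigHeatCoercivePos`). No literature claim: every node named below is an
internally-minted OPEN QUESTION of the cell or bookkeeping over one.]

CONTEXT. Door D-K6 (c) of the cell's records is the symmetrised core
`topBotEigMoment q = Φ_q + Ψ_q = ∫(λ₁⁺)^q + ∫((−λ₃)⁺)^q`; its two dictionary nodes are the
candidate law `TopBotEigMomentLaw q` and the symmetrised L-λ lemma
`TopBotEigHeatCoercivePos q : ∃ c > 0, HeatCoercive (Φ_q + Ψ_q) c`. The companion staged file K5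
(`NoGo/TopBotEigSaturatingSup`) proves law ⇐ lemma for real `q ≥ 2`. THIS FILE concerns the lemma's
node itself. The dictionary's `heatDissipation Φ v` is a SUPREMUM of backward secant quotients along
the heat line `t ↦ v + tΔv` (junk `0` when unbounded), so it is not additive in `Φ` for free; it is
additive for functionals CONVEX along the heat line, where it equals minus the right derivative
(`heatDissipation_eq_neg_rightDeriv`).

CONTENT (namespace `Summit.NavierStokesRegularity.FunctionalMining.TopEig`; `d = Fin 3` from §3 on).
§1 `heatDissipation_add_of_convexOn`: for two functionals convex along the heat line at `v`,
   `heatDissipation (Φ + Ψ) v = heatDissipation Φ v + heatDissipation Ψ v` (any `d`).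
§2 `heatDissipation_topBotEigMoment` (`q ≥ 1`, smooth `v`): the heat price of `Φ_q + Ψ_q` is the SUM
   of the two one-sided heat prices — the kernel form of the pen step of the cell's census of (c)
   (along a test family the symmetrised price is `T_Φ + T_Ψ`).
§3 Calibration and CEILING: on a Laplace eigenfield `Δv = −cv` the price is `qc·(Φ_q + Ψ_q)(v)`;
   the single-shell crossed shear refutes every rate above the first-shell value:
   `topBotEigHeatCoercive_rate_le : HeatCoercive (Φ_q + Ψ_q) c → c ≤ 4π²q` and
   `not_topBotEigHeatCoercive_of_lt` (`q ≥ 1`).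
§4 ORDERING OF THE TWO OPEN NODES: `TopEigHeatCoercive q c₁ → NegBotEigHeatCoercive q c₂ →
   HeatCoercive (Φ_q + Ψ_q) (min c₁ c₂)`; hence `TopEigHeatCoercive q c → HeatCoercive (Φ_q + Ψ_q) c`
   (the `−λ₃` row IS the `λ₁` row, `negBotEigHeatCoercive_iff`), `TopEigHeatCoercivePos q →
   TopBotEigHeatCoercivePos q`, and the KILL ORDERING `¬TopBotEigHeatCoercivePos q →
   ¬TopEigHeatCoercivePos q` / `→ topEigHeatRate q = 0`: a kernel refutation of the symmetrised lemma
   would settle the one-sided constant `C_λ(q) = 0` too — killing (c)'s heat node is AT LEAST AS HARD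
   as the standing one-sided kernel kill.
§5 The symmetrised constant `topBotEigHeatRate q := heatRate (Φ_q + Ψ_q)` =: `C_λ^sym(q)`: the heat
   sieve `topBotEigHeatCoercive_zero`, attainment, `HeatCoercive (Φ_q + Ψ_q) c ↔ c ≤ C_λ^sym(q)`, the
   KERNEL WINDOW `C_λ(q) ≤ C_λ^sym(q) ≤ 4π²q`, `TopBotEigHeatCoercivePos q ↔ 0 < C_λ^sym(q)`,
   `¬… ↔ C_λ^sym(q) = 0`, `C_λ^sym(q) = 0 → C_λ(q) = 0`, and the BOOKING FORM of an explicit-field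
   upper bound `C_λ^sym(q) ≤ (T_Φ(v) + T_Ψ(v)) / (Φ_q + Ψ_q)(v)` (strict version for a future kill).

NOT claimed: neither `TopBotEigHeatCoercivePos q` nor `TopEigHeatCoercivePos q` is decided for any `q`
(both OPEN, conjecture nodes of the dictionary); no value of either constant inside its window; nothing
about the law node (that is K5). search for candidate a priori estimates; no regularity claim.
FILING (prove seat g26, REQUEST #20): declarations byte-identical to the no-go seat's staged `TopBotEigHeatWindow.STAGING.lean` 2e05564aa850cc18; this line is the only addition.
-/

noncomputable section

open MeasureTheory Set Filter Topology Real

namespace Summit.NavierStokesRegularity.FunctionalMining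

open Literature.Analysis Literature.Analysis.FunctionSpaces Literature.Analysis.FunctionSpaces.Torus
  Literature.Analysis.FluidPDE

namespace TopEig

open CrossedShear StrainL4

/-! ## §1 Additivity of the heat price for functionals convex along the heat line -/

section Additivity

variable {d : Type*} [Fintype d]

/-- **`heatDissipation (Φ + Ψ) v = heatDissipation Φ v + heatDissipation Ψ v`** whenever both
`t ↦ Φ(v + tΔv)` and `t ↦ Ψ(v + tΔv)` are convex on `ℝ`: each heat price is minus a right derivative
(`heatDissipation_eq_neg_rightDeriv`) and right derivatives add. Without convexity the supremum in
`heatDissipation` is only subadditive (or junk). [folklore; over the dictionary's definition] -/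
theorem heatDissipation_add_of_convexOn {Φ Ψ : (UnitAddTorus d → EuclideanSpace ℝ d) → ℝ}
    {v : UnitAddTorus d → EuclideanSpace ℝ d}
    (hΦ : ConvexOn ℝ univ (fun t : ℝ => Φ (v + t • Torus.laplacian v)))
    (hΨ : ConvexOn ℝ univ (fun t : ℝ => Ψ (v + t • Torus.laplacian v))) :
    heatDissipation (fun w => Φ w + Ψ w) v = heatDissipation Φ v + heatDissipation Ψ v := by
  obtain ⟨hdΦ, eΦ⟩ := heatDissipation_eq_neg_rightDeriv hΦ
  obtain ⟨hdΨ, eΨ⟩ := heatDissipation_eq_neg_rightDeriv hΨ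
  have hsum : ConvexOn ℝ univ
      (fun t : ℝ => (fun w => Φ w + Ψ w) (v + t • Torus.laplacian v)) :=
    (hΦ.add hΨ).congr fun _ _ => rfl
  obtain ⟨-, eS⟩ := heatDissipation_eq_neg_rightDeriv (Φ := fun w => Φ w + Ψ w) (v := v) hsum
  beta_reduce at eS
  have hd : HasDerivWithinAt
      (fun t : ℝ => Φ (v + t • Torus.laplacian v) + Ψ (v + t • Torus.laplacian v))
      (derivWithin (fun t : ℝ => Φ (v + t • Torus.laplacian v)) (Ioi 0) 0 +
        derivWithin (fun t : ℝ => Ψ (v + t • Torus.laplacian v)) (Ioi 0) 0) (Ioi 0) 0 :=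
    hdΦ.add hdΨ
  rw [eS, eΦ, eΨ, hd.derivWithin (uniqueDiffWithinAt_Ioi 0)]
  ring

end Additivity

/-! ## §2 The symmetrised core: its heat price is the sum of the one-sided heat prices -/

section Symmetrised

variable {d : Type*} [Fintype d] [DecidableEq d] [Nonempty d]

/-- `t ↦ (Φ_q + Ψ_q)(v + t w)` is convex for smooth `v, w` and `q ≥ 1` (sum of the tree's two convex
heat lines `convexOn_topEigMoment_line`, `convexOn_negBotEigMoment_line`). [ours, bookkeeping] -/
theorem convexOn_topBotEigMoment_line {q : ℝ} (hq : 1 ≤ q)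
    {v w : UnitAddTorus d → EuclideanSpace ℝ d} (hv : Torus.IsSmooth v) (hw : Torus.IsSmooth w) :
    ConvexOn ℝ univ (fun t : ℝ => topBotEigMoment q (v + t • w)) :=
  ((convexOn_topEigMoment_line hq hv hw).add (convexOn_negBotEigMoment_line hq hv hw)).congr
    fun _ _ => rfl

/-- **The heat price of the symmetrised core is the sum of the one-sided heat prices**:
`heatDissipation (Φ_q + Ψ_q) v = heatDissipation Φ_q v + heatDissipation Ψ_q v` for smooth `v` and
`q ≥ 1`. [ours] -/
theorem heatDissipation_topBotEigMoment {q : ℝ} (hq : 1 ≤ q)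
    {v : UnitAddTorus d → EuclideanSpace ℝ d} (hv : Torus.IsSmooth v) :
    heatDissipation (topBotEigMoment q) v =
      heatDissipation (torusTopEigMoment q) v + heatDissipation (torusNegBotEigMoment q) v :=
  heatDissipation_add_of_convexOn (convexOn_topEigMoment_line hq hv hv.laplacian)
    (convexOn_negBotEigMoment_line hq hv hv.laplacian)

/-- **Calibration on Laplace eigenfields**: `Δv = −cv` (`c ≥ 0`), `q ≥ 1` ⇒
`heatDissipation (Φ_q + Ψ_q) v = q c (Φ_q + Ψ_q)(v)`. [ours, calibration] -/
theorem heatDissipation_topBotEigMoment_of_laplacian_eq {q : ℝ} (hq : 1 ≤ q) {c : ℝ} (hc : 0 ≤ c)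
    {v : UnitAddTorus d → EuclideanSpace ℝ d} (hv : Torus.IsSmooth v)
    (hΔ : Torus.laplacian v = -(c • v)) :
    heatDissipation (topBotEigMoment q) v = q * c * topBotEigMoment q v := by
  rw [heatDissipation_topBotEigMoment hq hv, heatDissipation_topEigMoment_of_laplacian_eq hq hc hv hΔ,
    heatDissipation_negBotEigMoment_of_laplacian_eq hq hc hv hΔ, topBotEigMoment]
  ring

end Symmetrised

/-! ## §3 The ceiling: no rate above the first-shell value `4π²q` -/

/-- **`HeatCoercive (Φ_q + Ψ_q) c → c ≤ 4π²q`** (`q ≥ 1`; witness: the single-shell crossed shear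
`u = csField E₀ E₀`, `Δu = −4π²u`, where the price is `4π²q (Φ_q + Ψ_q)(u)` and both cores are
positive). [ours, calibration] -/
theorem topBotEigHeatCoercive_rate_le {q c : ℝ} (hq : 1 ≤ q)
    (h : HeatCoercive (d := Fin 3) (topBotEigMoment q) c) : c ≤ 4 * π ^ 2 * q := by
  have hu : Torus.IsSmooth (csField (expP 0) (expP 0)) := isSmooth_csField _ _
  have hcal := heatDissipation_topBotEigMoment_of_laplacian_eq hq
    (by positivity : (0 : ℝ) ≤ 4 * π ^ 2) hu laplacian_csField_expP_zero
  have hL := h (by simp) (csField (expP 0) (expP 0)) hu (isDivFree_csField _ _)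
    (hasZeroMean_csField _ _)
  rw [hcal] at hL
  have hpos : 0 < topBotEigMoment q (csField (expP 0) (expP 0)) := by
    unfold topBotEigMoment
    exact add_pos (torusTopEigMoment_csField_pos (q := q) (by linarith))
      (torusNegBotEigMoment_csField_pos (q := q) (by linarith))
  have : c ≤ q * (4 * π ^ 2) := le_of_mul_le_mul_right (by linarith) hpos
  linarith

/-- No rate `c > 4π²q` is admissible for the symmetrised core (`q ≥ 1`). [ours, calibration] -/
theorem not_topBotEigHeatCoercive_of_lt {q c : ℝ} (hq : 1 ≤ q) (hc : 4 * π ^ 2 * q < c) :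
    ¬ HeatCoercive (d := Fin 3) (topBotEigMoment q) c := fun h =>
  absurd (topBotEigHeatCoercive_rate_le hq h) (not_le.2 hc)

/-! ## §4 Ordering of the two open nodes: one-sided coercivity gives symmetrised coercivity -/

/-- **`TopEigHeatCoercive q c₁ → NegBotEigHeatCoercive q c₂ → HeatCoercive (Φ_q + Ψ_q) (min c₁ c₂)`**
(`q ≥ 1`): by §2 the symmetrised price is the sum of the one-sided prices. [ours] -/
theorem topBotEigHeatCoercive_of_rates {q c₁ c₂ : ℝ} (hq : 1 ≤ q)
    (h₁ : TopEigHeatCoercive (d := Fin 3) q c₁) (h₂ : NegBotEigHeatCoercive (d := Fin 3) q c₂) :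
    HeatCoercive (d := Fin 3) (topBotEigMoment q) (min c₁ c₂) := by
  intro hd v hv hdiv hmean
  rw [heatDissipation_topBotEigMoment hq hv, topBotEigMoment]
  have e₁ := h₁ hd v hv hdiv hmean
  have e₂ := h₂ hd v hv hdiv hmean
  have m₁ : min c₁ c₂ * torusTopEigMoment q v ≤ c₁ * torusTopEigMoment q v :=
    mul_le_mul_of_nonneg_right (min_le_left _ _) (torusTopEigMoment_nonneg q v)
  have m₂ : min c₁ c₂ * torusNegBotEigMoment q v ≤ c₂ * torusNegBotEigMoment q v :=
    mul_le_mul_of_nonneg_right (min_le_right _ _) (torusNegBotEigMoment_nonneg q v)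
  rw [mul_add]
  linarith

/-- **`TopEigHeatCoercive q c → HeatCoercive (Φ_q + Ψ_q) c`** (`q ≥ 1`; the `−λ₃` row at rate `c` IS
the `λ₁` row at rate `c`, `negBotEigHeatCoercive_iff`). [ours] -/
theorem topBotEigHeatCoercive_of_topEigHeatCoercive {q c : ℝ} (hq : 1 ≤ q)
    (h : TopEigHeatCoercive (d := Fin 3) q c) : HeatCoercive (d := Fin 3) (topBotEigMoment q) c := by
  have h' := topBotEigHeatCoercive_of_rates hq h ((negBotEigHeatCoercive_iff q c).2 h)
  rwa [min_self] at h'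

/-- **Lemma L-λ(q) implies the symmetrised L-λ lemma: `TopEigHeatCoercivePos q →
TopBotEigHeatCoercivePos q`** (`q ≥ 1`). [ours] -/
theorem topBotEigHeatCoercivePos_of_topEigHeatCoercivePos {q : ℝ} (hq : 1 ≤ q)
    (h : TopEigHeatCoercivePos (d := Fin 3) q) : TopBotEigHeatCoercivePos (d := Fin 3) q := by
  obtain ⟨c, hc, hL⟩ := h
  exact ⟨c, hc, topBotEigHeatCoercive_of_topEigHeatCoercive hq hL⟩

/-- **KILL ORDERING: `¬TopBotEigHeatCoercivePos q → ¬TopEigHeatCoercivePos q`** (`q ≥ 1`) — a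
refutation of (c)'s heat node refutes Lemma L-λ(q) for the `λ₁` core as well; killing the symmetrised
lemma is at least as hard as killing the one-sided one. [ours] -/
theorem not_topEigHeatCoercivePos_of_not_topBot {q : ℝ} (hq : 1 ≤ q)
    (h : ¬ TopBotEigHeatCoercivePos (d := Fin 3) q) : ¬ TopEigHeatCoercivePos (d := Fin 3) q :=
  fun hL => h (topBotEigHeatCoercivePos_of_topEigHeatCoercivePos hq hL)

/-- The same for the `−λ₃` core: `¬TopBotEigHeatCoercivePos q → ¬NegBotEigHeatCoercivePos q`
(`q ≥ 1`). [ours] -/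
theorem not_negBotEigHeatCoercivePos_of_not_topBot {q : ℝ} (hq : 1 ≤ q)
    (h : ¬ TopBotEigHeatCoercivePos (d := Fin 3) q) : ¬ NegBotEigHeatCoercivePos (d := Fin 3) q :=
  fun hL => not_topEigHeatCoercivePos_of_not_topBot hq h ((negBotEigHeatCoercivePos_iff q).1 hL)

/-- **In terms of the dictionary's constant: `¬TopBotEigHeatCoercivePos q → C_λ(q) = 0`** (`q ≥ 1`;
`not_topEigHeatCoercivePos_iff_rate_eq_zero`). [ours, bookkeeping] -/
theorem topEigHeatRate_eq_zero_of_not_topBot {q : ℝ} (hq : 1 ≤ q)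
    (h : ¬ TopBotEigHeatCoercivePos (d := Fin 3) q) : topEigHeatRate q = 0 :=
  (not_topEigHeatCoercivePos_iff_rate_eq_zero hq).1 (not_topEigHeatCoercivePos_of_not_topBot hq h)

/-! ## §5 The symmetrised constant `C_λ^sym(q)` and its kernel window `[C_λ(q), 4π²q]` -/

/-- **`C_λ^sym(q) := sup {c | HeatCoercive (Φ_q + Ψ_q) c}`** — the heat-coercivity constant of the
symmetrised core on `T³` (the dictionary's `heatRate`). [ours, bookkeeping] -/
def topBotEigHeatRate (q : ℝ) : ℝ :=
  heatRate (d := Fin 3) (topBotEigMoment q)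

/-- `C_λ^sym(q)` is literally `sSup {c | HeatCoercive (Φ_q + Ψ_q) c}`. [ours, bookkeeping] -/
theorem topBotEigHeatRate_eq_sSup (q : ℝ) :
    topBotEigHeatRate q = sSup {c : ℝ | HeatCoercive (d := Fin 3) (topBotEigMoment q) c} :=
  rfl

/-- **The symmetrised core passes the heat sieve: `HeatCoercive (Φ_q + Ψ_q) 0`** (`q ≥ 1`; from the
tree's one-sided sieve `topEigHeatCoercive_zero` by §4). [ours] -/
theorem topBotEigHeatCoercive_zero {q : ℝ} (hq : 1 ≤ q) :
    HeatCoercive (d := Fin 3) (topBotEigMoment q) 0 :=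
  topBotEigHeatCoercive_of_topEigHeatCoercive hq (topEigHeatCoercive_zero hq)

/-- The admissible rates of the symmetrised core are bounded above by `4π²q` (§3). [ours, bookkeeping] -/
theorem bddAbove_heatRateSet_topBotEigMoment {q : ℝ} (hq : 1 ≤ q) :
    BddAbove (heatRateSet (d := Fin 3) (topBotEigMoment q)) :=
  ⟨4 * π ^ 2 * q, fun _ hc => topBotEigHeatCoercive_rate_le hq hc⟩

/-- **Attainment: `HeatCoercive (Φ_q + Ψ_q) (C_λ^sym(q))`** (`q ≥ 1`; the dictionary's
`heatCoercive_heatRate`). [ours, bookkeeping] -/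
theorem topBotEigHeatCoercive_topBotEigHeatRate {q : ℝ} (hq : 1 ≤ q) :
    HeatCoercive (d := Fin 3) (topBotEigMoment q) (topBotEigHeatRate q) :=
  heatCoercive_heatRate (topBotEigMoment_nonneg q) (topBotEigHeatCoercive_zero hq)

/-- **`HeatCoercive (Φ_q + Ψ_q) c ↔ c ≤ C_λ^sym(q)`** (`q ≥ 1`). [ours, bookkeeping] -/
theorem topBotEigHeatCoercive_iff_le_rate {q c : ℝ} (hq : 1 ≤ q) :
    HeatCoercive (d := Fin 3) (topBotEigMoment q) c ↔ c ≤ topBotEigHeatRate q :=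
  heatCoercive_iff_le_heatRate (topBotEigMoment_nonneg q) (topBotEigHeatCoercive_zero hq)
    (bddAbove_heatRateSet_topBotEigMoment hq)

/-- The rate set is the closed ray `{c | HeatCoercive (Φ_q + Ψ_q) c} = Iic (C_λ^sym(q))` (`q ≥ 1`).
[ours, bookkeeping] -/
theorem heatRateSet_topBotEigMoment_eq_Iic {q : ℝ} (hq : 1 ≤ q) :
    heatRateSet (d := Fin 3) (topBotEigMoment q) = Iic (topBotEigHeatRate q) :=
  Set.ext fun _ => topBotEigHeatCoercive_iff_le_rate hq

/-- **Lower end of the window: `C_λ(q) ≤ C_λ^sym(q)`** (`q ≥ 1`) — the symmetrised constant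
dominates the one-sided one (§4 at the attained one-sided rate). [ours] -/
theorem topEigHeatRate_le_topBotEigHeatRate {q : ℝ} (hq : 1 ≤ q) :
    topEigHeatRate q ≤ topBotEigHeatRate q :=
  (topBotEigHeatCoercive_iff_le_rate hq).1
    (topBotEigHeatCoercive_of_topEigHeatCoercive hq (topEigHeatCoercive_topEigHeatRate hq))

/-- `0 ≤ C_λ^sym(q)` (`q ≥ 1`). [ours, bookkeeping] -/
theorem topBotEigHeatRate_nonneg {q : ℝ} (hq : 1 ≤ q) : 0 ≤ topBotEigHeatRate q :=
  (topEigHeatRate_nonneg hq).trans (topEigHeatRate_le_topBotEigHeatRate hq)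

/-- **Upper end of the window: `C_λ^sym(q) ≤ 4π²q`** (`q ≥ 1`; §3). [ours, calibration] -/
theorem topBotEigHeatRate_le {q : ℝ} (hq : 1 ≤ q) : topBotEigHeatRate q ≤ 4 * π ^ 2 * q :=
  topBotEigHeatCoercive_rate_le hq (topBotEigHeatCoercive_topBotEigHeatRate hq)

/-- **KERNEL WINDOW: `C_λ^sym(q) ∈ [C_λ(q), 4π²q]`** for every real `q ≥ 1`. [ours] -/
theorem topBotEigHeatRate_mem_Icc {q : ℝ} (hq : 1 ≤ q) :
    topBotEigHeatRate q ∈ Icc (topEigHeatRate q) (4 * π ^ 2 * q) :=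
  ⟨topEigHeatRate_le_topBotEigHeatRate hq, topBotEigHeatRate_le hq⟩

/-- **The symmetrised L-λ lemma ⟺ its constant is positive:
`TopBotEigHeatCoercivePos q ↔ 0 < C_λ^sym(q)`** (`q ≥ 1`). [ours, bookkeeping] -/
theorem topBotEigHeatCoercivePos_iff_rate_pos {q : ℝ} (hq : 1 ≤ q) :
    TopBotEigHeatCoercivePos (d := Fin 3) q ↔ 0 < topBotEigHeatRate q := by
  constructor
  · rintro ⟨c, hc, h⟩
    exact hc.trans_le ((topBotEigHeatCoercive_iff_le_rate hq).1 h)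
  · exact fun h => ⟨_, h, topBotEigHeatCoercive_topBotEigHeatRate hq⟩

/-- **`¬TopBotEigHeatCoercivePos q ↔ C_λ^sym(q) = 0`** (`q ≥ 1`): the negative side of (c)'s heat
node says the window's value is `0` (then its lower end `C_λ(q)` is `0` too). [ours, bookkeeping] -/
theorem not_topBotEigHeatCoercivePos_iff_rate_eq_zero {q : ℝ} (hq : 1 ≤ q) :
    ¬ TopBotEigHeatCoercivePos (d := Fin 3) q ↔ topBotEigHeatRate q = 0 := by
  rw [topBotEigHeatCoercivePos_iff_rate_pos hq, not_lt]
  exact ⟨fun h => le_antisymm h (topBotEigHeatRate_nonneg hq), fun h => h.le⟩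

/-- **Kill ordering for the constants: `C_λ^sym(q) = 0 → C_λ(q) = 0`** (`q ≥ 1`). [ours] -/
theorem topEigHeatRate_eq_zero_of_topBotEigHeatRate_eq_zero {q : ℝ} (hq : 1 ≤ q)
    (h : topBotEigHeatRate q = 0) : topEigHeatRate q = 0 :=
  le_antisymm (h ▸ topEigHeatRate_le_topBotEigHeatRate hq) (topEigHeatRate_nonneg hq)

/-- Conversely a positive one-sided constant forces a positive symmetrised one:
`0 < C_λ(q) → 0 < C_λ^sym(q)` (`q ≥ 1`). [ours, bookkeeping] -/
theorem topBotEigHeatRate_pos_of_topEigHeatRate_pos {q : ℝ} (hq : 1 ≤ q)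
    (h : 0 < topEigHeatRate q) : 0 < topBotEigHeatRate q :=
  h.trans_le (topEigHeatRate_le_topBotEigHeatRate hq)

/-- A refuted rate is a STRICT upper bound: `¬HeatCoercive (Φ_q + Ψ_q) c → C_λ^sym(q) < c` (`q ≥ 1`).
[ours, bookkeeping] -/
theorem topBotEigHeatRate_lt_of_not {q c : ℝ} (hq : 1 ≤ q)
    (h : ¬ HeatCoercive (d := Fin 3) (topBotEigMoment q) c) : topBotEigHeatRate q < c := by
  by_contra hle
  exact h ((topBotEigHeatCoercive_iff_le_rate hq).2 (not_lt.1 hle))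

/-- **BOOKING FORM of an explicit-field upper bound: `C_λ^sym(q) ≤ (T_Φ(v) + T_Ψ(v)) / (Φ_q + Ψ_q)(v)`**
for every smooth, divergence-free, zero-mean `v` on `T³` with `(Φ_q + Ψ_q)(v) > 0` (`q ≥ 1`): the
numerator is the SUM of the two one-sided heat prices (§2) — the quantity a kill family for (c) has to
drive to `0` relative to the core. [ours, bookkeeping] -/
theorem topBotEigHeatRate_le_ratio {q : ℝ} (hq : 1 ≤ q)
    (v : UnitAddTorus (Fin 3) → EuclideanSpace ℝ (Fin 3)) (hv : Torus.IsSmooth v)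
    (hdiv : Torus.IsDivFree v) (hmean : Torus.HasZeroMean v) (hΦ : 0 < topBotEigMoment q v) :
    topBotEigHeatRate q ≤
      (heatDissipation (torusTopEigMoment q) v + heatDissipation (torusNegBotEigMoment q) v) /
        topBotEigMoment q v := by
  rw [le_div_iff₀ hΦ, ← heatDissipation_topBotEigMoment hq hv]
  exact topBotEigHeatCoercive_topBotEigHeatRate hq (by simp) v hv hdiv hmean

/-- **Strict form: ONE test field with `T_Φ(v) + T_Ψ(v) < c · (Φ_q + Ψ_q)(v)` gives `C_λ^sym(q) < c`**
(`q ≥ 1`); with `c ↓ 0` along a family this is the shape of a kill of (c)'s heat node. [ours, bookkeeping] -/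
theorem topBotEigHeatRate_lt_of_ratio_lt {q c : ℝ} (hq : 1 ≤ q)
    (v : UnitAddTorus (Fin 3) → EuclideanSpace ℝ (Fin 3)) (hv : Torus.IsSmooth v)
    (hdiv : Torus.IsDivFree v) (hmean : Torus.HasZeroMean v) (hΦ : 0 < topBotEigMoment q v)
    (h : heatDissipation (torusTopEigMoment q) v + heatDissipation (torusNegBotEigMoment q) v <
      c * topBotEigMoment q v) :
    topBotEigHeatRate q < c :=
  lt_of_le_of_lt (topBotEigHeatRate_le_ratio hq v hv hdiv hmean hΦ) ((div_lt_iff₀ hΦ).2 h)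

/-- **Summary of the node (every real `q ≥ 1`)**: the one-sided lemma implies the symmetrised one, no
rate above `4π²q` is admissible, and the symmetrised constant lies in `[C_λ(q), 4π²q]`. [ours] -/
theorem topBotEigHeat_window_summary {q : ℝ} (hq : 1 ≤ q) :
    (TopEigHeatCoercivePos (d := Fin 3) q → TopBotEigHeatCoercivePos (d := Fin 3) q) ∧
      (∀ c : ℝ, 4 * π ^ 2 * q < c → ¬ HeatCoercive (d := Fin 3) (topBotEigMoment q) c) ∧
      topBotEigHeatRate q ∈ Icc (topEigHeatRate q) (4 * π ^ 2 * q) :=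
  ⟨topBotEigHeatCoercivePos_of_topEigHeatCoercivePos hq, fun _ hc => not_topBotEigHeatCoercive_of_lt hq hc,
    topBotEigHeatRate_mem_Icc hq⟩

end TopEig

end Summit.NavierStokesRegularity.FunctionalMining

end
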